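import Summits.QuantumFields.YangMills.Theses.BackwardLiouvilleRigidity
import Literature.MathematicalPhysics.QuantumFieldTheory.Balaban1983to89.T4AveragingDisintegration
import HarnessLib

/-!
# Crux `OneStepBackwardContractionAdm` (stmt-QuantumFields-23156, route `BackwardLiouvilleRigidity`, rung R3), LINE 2 «organ-fibre-laplace»
# (planner ym-r3-idea-1 g12/g13): stub D `stub_descentDisintegration` — DISINTEGRATION OF THE PRODUCT HAAR MEASURE ALONG THE ONE-STEP DESCENT

For every `T3Family F` and level `j` a Markov kernel `σ_j : T_j ⇝ T_{j+1}` of fibre laws with `(descend_* dU).bind σ_j = dU` and,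
for `descend_* dU`-a.e. `V`, `σ_{j,V}`-a.e. `descend U = V` (Bałaban's kernel `t(V,U)dU`, [Balaban1987RG1] (0.13) p.254, in the
push-forward reading).

PROOF = the tree's generic one-step disintegration `Literature.…Balaban1983to89.T4AveragingDisintegration` (§1: joint law
`jointLaw ν avg = ν.map (U ↦ (avg U, U))`, conditional kernel `condLaw ν avg = (jointLaw ν avg).condKernel` — Markov,
`fst_compProd_condLaw : (jointLaw).fst ⊗ₘ condLaw = jointLaw`, `jointLaw_fst/snd`, and the kernel form of `δ(ŪV⁻¹)`
`condLaw_fibre_ae`; §2b: `SU(N)` and its gauge-field spaces are standard Borel) at `ν := fieldMeasure (F.P (j+1)) 0 SU(2)`,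
`avg := descend F ℰp j` (measurable: `T3NestedUnitLaws.measurable_descend`, `measurableE_ℰp`): `σ := condLaw ν (descend F ℰp j)`;
the `bind` clause is the second marginal of the disintegration (`Measure.snd_compProd`), the fibre clause is `condLaw_fibre_ae`.

Width seat ym-line-sfw-p2-w3 g28 (cell ym-idea-1; free hands, R3 family), `--supports stmt-QuantumFields-23156`.  THEOREMS ONLY.
HONEST FRAMING: [folklore] measure theory; the organ's content is stub S (`stub_fibreStepAdm`, XL, OPEN); no organ, crux, rung
(R3 is a RECORD rung) or summit is proved; the Yang–Mills mass gap is NOT proved by any of this.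
-/

set_option autoImplicit false

noncomputable section

namespace Summit.QuantumFields.YangMills.Theorems.BackwardLiouvilleRigidity.FibreLaplace

open MeasureTheory ProbabilityTheory
open Literature.MathematicalPhysics.QuantumFieldTheory.Balaban1983to89
open Literature.MathematicalPhysics.QuantumFieldTheory.Balaban1983to89.T4AveragingDisintegration
  (jointLaw condLaw jointLaw_fst jointLaw_snd fst_compProd_condLaw condLaw_fibre_ae)

/-- **Stub D of «organ-fibre-laplace» (crux stmt-QuantumFields-23156) — disintegration of `dU` along `descend`**: a Markov kernel of
fibre laws with `(descend_* dU).bind σ = dU`, carried by the fibres a.e. [cite: Balaban1987RG1, (0.13) p.254] -/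
theorem stub_descentDisintegration :
    open scoped Classical in open MeasureTheory ProbabilityTheory Filter Topology Literature.MathematicalPhysics.QuantumFieldTheory.Balaban1983to89 T3ContinuumYM3Torus T3NestedUnitLaws T3UnitLawDensityEML BalabanUVClass T3UnitScaleTilt in ∀ (F : T3Family) (j : ℕ), ∃ σ : ProbabilityTheory.Kernel (GaugeField (F.P j) 0 ↥(Matrix.specialUnitaryGroup (Fin 2) ℂ)) (GaugeField (F.P (j + 1)) 0 ↥(Matrix.specialUnitaryGroup (Fin 2) ℂ)), ProbabilityTheory.IsMarkovKernel σ ∧ (Measure.map (descend F ℰp j) (fieldMeasure (F.P (j + 1)) 0 ↥(Matrix.specialUnitaryGroup (Fin 2) ℂ))).bind ⇑σ = fieldMeasure (F.P (j + 1)) 0 ↥(Matrix.specialUnitaryGroup (Fin 2) ℂ) ∧ ∀ᵐ V ∂(Measure.map (descend F ℰp j) (fieldMeasure (F.P (j + 1)) 0 ↥(Matrix.specialUnitaryGroup (Fin 2) ℂ))), ∀ᵐ U ∂(σ V), descend F ℰp j U = V := by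
  intro F j
  have havg : Measurable (T3NestedUnitLaws.descend F T3UnitLawDensityEML.ℰp j :
      GaugeField (F.P (j + 1)) 0 ↥(Matrix.specialUnitaryGroup (Fin 2) ℂ) →
        GaugeField (F.P j) 0 ↥(Matrix.specialUnitaryGroup (Fin 2) ℂ)) :=
    T3NestedUnitLaws.measurable_descend F T3UnitLawDensityEML.ℰp T3UnitLawDensityEML.measurableE_ℰp j
  haveI : Nonempty (GaugeField (F.P (j + 1)) 0 ↥(Matrix.specialUnitaryGroup (Fin 2) ℂ)) := ⟨fun _ => 1⟩
  set ν : Measure (GaugeField (F.P (j + 1)) 0 ↥(Matrix.specialUnitaryGroup (Fin 2) ℂ)) :=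
    fieldMeasure (F.P (j + 1)) 0 ↥(Matrix.specialUnitaryGroup (Fin 2) ℂ) with hν
  refine ⟨condLaw ν (T3NestedUnitLaws.descend F T3UnitLawDensityEML.ℰp j), inferInstance, ?_, ?_⟩
  · -- the `bind` clause: second marginal of the disintegration
    have h := fst_compProd_condLaw ν (T3NestedUnitLaws.descend F T3UnitLawDensityEML.ℰp j)
    rw [jointLaw_fst ν havg] at h
    have h2 := congrArg Measure.snd h
    rw [Measure.snd_compProd, jointLaw_snd ν havg] at h2
    exact h2
  · -- the fibre clause
    filter_upwards [condLaw_fibre_ae ν havg] with V hV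
    rw [ae_iff]
    exact (prob_compl_eq_zero_iff (measurableSet_eq_fun havg measurable_const)).2 hV

end Summit.QuantumFields.YangMills.Theorems.BackwardLiouvilleRigidity.FibreLaplace

end
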